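import Summits.CriticalPhenomena.CardyFormulaZ2.Theorems.SymmetryUpgradeR.Negative.DiracMarkov
import Summits.CriticalPhenomena.CardyFormulaZ2.Theorems.SymmetryUpgradeR.Negative.TiltedRayChord
import HarnessLib

/-!
# Tilted rays, II: conformally covariant deterministic typed-Markov families; the typed Schramm principle fails

Crux `SymmetryUpgradeR` (stmt-CriticalPhenomena-17239, route `CardySelfRefinement`), line `SketchIdeatorTwo`,
negative side: the lead's structural theorem behind the verdict on stubs S7 `stub_pinnedSchrammLSW` /
S5a `stub_middleDrivingMartingale` — the typed domain Markov property `ChordalFamily.IsDomainMarkov`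
cannot carry Schramm's increment argument (headline in `TiltedRayFamily.lean`:
`typedSchrammPrinciple_fails`).

The **`u`-ray family** `rayFamily u` (`Im u > 0`): Dirac mass at the class of the ray chord of
`(D; a, b)` through a chosen chordal uniformizing map (`uniformizer`, from
`MarkedDomain.exists_isChordalUniformizing_holds`). It is a deterministic simple chord family
(`isSimpleChordFamily_rayChord`; dependence on `(carrier, a, b)` only, by uniqueness of uniformizing
maps up to dilation), hence chordal, non-tracing and domain Markov in the typed sense
(`DiracMarkov.lean`); and it is conformally covariant (`isConformallyCovariant_rayFamily`: the image
chord is the ray curve through `φ_D ≫ g`). For `u = i` this is the hyperbolic geodesic (chordal SLE₀);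
the vertical and the tilted (`u = 1 + i`) families differ in every domain (`rayChord_I_ne`). HEADLINE
`typedSchrammPrinciple_fails`: conformal covariance + the typed domain Markov property + chordality +
non-tracing do not determine a chordal family, not even among deterministic ones — whereas under
Werner's domain Markov property (conditional law in the SLIT domain = the family's own law there) a
deterministic conformally invariant chordal family is the geodesic (Schramm's principle, `κ = 0`). So the
typed `IsMarkovExtension` clause does not carry Schramm's increment argument (Werner 2007, Lemma 3.3),
the mechanism named by stub S5a and presupposed by S7 of line `SketchIdeatorTwo`; any typed Schramm
step must draw the slit-domain law from locality/target-independence or from the lattice (clause (iv)).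

References: W. Werner, *Lectures on two-dimensional critical percolation* (2007), §3.2 (2), Lemma 3.3;
O. Schramm, Israel J. Math. 118 (2000), §1; G. F. Lawler, *Conformally Invariant Processes in the Plane*
(2005), §6.3.
-/

noncomputable section

open Set MeasureTheory Topology Filter Metric
open scoped unitInterval ENNReal NNReal
open UpperHalfPlane (upperHalfPlaneSet)

namespace Summit.CriticalPhenomena.CardyFormulaZ2.Theorems.SymmetryUpgradeR.Negative

open Literature.Probability.RandomPlanarGeometry Literature.Probability.RandomPlanarGeometry.ChordalFamily

section RayFamily

open Complex

variable {D D' : DobrushinDomain}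

/-! ### The ray family -/

/-- A chordal uniformizing map of `(D; a, b)` (a choice; `MarkedDomain.exists_isChordalUniformizing_holds`). [folklore] -/
def uniformizer (D : DobrushinDomain) : ConformalEquiv upperHalfPlaneSet D.carrier :=
  (MarkedDomain.exists_isChordalUniformizing_holds D).choose

/-- The chosen map is chordal uniformizing. [folklore] -/
theorem uniformizer_spec (D : DobrushinDomain) : D.IsChordalUniformizing (uniformizer D) :=
  (MarkedDomain.exists_isChordalUniformizing_holds D).choose_spec

/-- **The `u`-ray chord** of `(D; a, b)`: the ray curve through the chosen uniformizing map. [folklore] -/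
def rayChord (u : ℂ) (hu : 0 < u.im) (D : DobrushinDomain) : Curve ℂ :=
  rayCurveThrough hu (uniformizer_spec D)

/-- **The `u`-ray family**: Dirac mass at the class of the `u`-ray chord. [folklore] -/
def rayFamily (u : ℂ) (hu : 0 < u.im) : ChordalFamily := fun D => Measure.dirac (CurveClass.mk (rayChord u hu D))

/-- Re-targeting a conformal equivalence along an equality of target sets (same maps). [folklore] -/
def _root_.Literature.Probability.RandomPlanarGeometry.ConformalEquiv.copyTarget {U V W : Set ℂ}
    (φ : ConformalEquiv U V) (h : V = W) : ConformalEquiv U W :=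
  ⟨φ.toPartialEquiv, φ.source_eq, φ.target_eq.trans h, φ.differentiableOn, h ▸ φ.differentiableOn_symm⟩

/-- **The ray chords form a deterministic simple chord family** (`IsSimpleChordFamily`): injective
curves from `a` to `b` inside `D`, slit complements star-shaped (in the `ℍₒ` chart) hence
preconnected, slits nowhere dense, dependence on `(carrier, a, b)` only up to `rayScale`. [folklore] -/
theorem isSimpleChordFamily_rayChord {u : ℂ} (hu : 0 < u.im) : IsSimpleChordFamily (rayChord u hu) := by
  have hu0 : u ≠ 0 := (fun h0 => by rw [h0] at hu; simp at hu)
  refine ⟨fun D => rayCurveThrough_apply_zero hu _, fun D => rayCurveThrough_apply_one hu _,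
    fun D s h0 h1 => (rayCurveThrough_apply_mem hu (uniformizer_spec D) h0 h1).2.2, ?_, ?_, ?_, ?_⟩
  · -- injective
    intro D s t hst
    set φ := uniformizer D
    have hφ := uniformizer_spec D
    -- values in `D` exactly at interior times, `a` at `0`, `b` at `1`
    have hclass : ∀ s : I, (rayChord u hu D s = D.pt 0 ∧ (s : ℝ) = 0) ∨
        (rayChord u hu D s = D.pt 1 ∧ (s : ℝ) = 1) ∨
        (rayChord u hu D s ∈ D.carrier ∧ 0 < (s : ℝ) ∧ (s : ℝ) < 1) := by
      intro s
      rcases eq_or_lt_of_le s.2.1 with h0 | h0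
      · left
        have : s = 0 := Subtype.ext h0.symm
        subst this
        exact ⟨rayCurveThrough_apply_zero hu hφ, rfl⟩
      rcases eq_or_lt_of_le s.2.2 with h1 | h1
      · right; left
        have : s = 1 := Subtype.ext h1
        subst this
        exact ⟨rayCurveThrough_apply_one hu hφ, rfl⟩
      · right; right
        exact ⟨(rayCurveThrough_apply_mem hu hφ h0 h1).2.2, h0, h1⟩
    have ha : D.pt 0 ∉ D.carrier := D.pt_notMem_carrier 0
    have hb : D.pt 1 ∉ D.carrier := D.pt_notMem_carrier 1
    have hab : D.pt 0 ≠ D.pt 1 := fun h => zero_ne_one (D.pt_injective h)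
    change rayChord u hu D s = rayChord u hu D t at hst
    rcases hclass s with ⟨hs, hs0⟩ | ⟨hs, hs1⟩ | ⟨hs, hs0, hs1⟩ <;>
      rcases hclass t with ⟨ht, ht0⟩ | ⟨ht, ht1⟩ | ⟨ht, ht0, ht1⟩
    · exact Subtype.ext (hs0.trans ht0.symm)
    · exact absurd (hs.symm.trans (hst.trans ht)) hab
    · exact absurd (hs ▸ hst ▸ ht) ha
    · exact absurd (ht.symm.trans (hst.symm.trans hs)) hab
    · exact Subtype.ext (hs1.trans ht1.symm)
    · exact absurd (hs ▸ hst ▸ ht) hb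
    · exact absurd (ht ▸ hst.symm ▸ hs) ha
    · exact absurd (ht ▸ hst.symm ▸ hs) hb
    · -- both interior: injectivity of `φ` on `ℍₒ`, of the ray, and of `rayParam` on `[0, 1)`
      obtain ⟨hs', hsm, -⟩ := rayCurveThrough_apply_mem hu hφ hs0 hs1
      obtain ⟨ht', htm, -⟩ := rayCurveThrough_apply_mem hu hφ ht0 ht1
      change rayCurveThrough hu hφ s = rayCurveThrough hu hφ t at hst
      rw [hs', ht'] at hst
      have h1 := φ.injOn hsm htm hst
      have h2 := ray_injective hu0 h1
      exact rayParam_injOn hs1 ht1 h2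
  · -- slit complements are preconnected (star-shaped in the chart)
    intro D r hr
    rcases lt_or_ge r 0 with h0 | h0
    · have he : rayChord u hu D '' {s : I | 0 < (s : ℝ) ∧ (s : ℝ) ≤ r} = ∅ := by
        rw [Set.image_eq_empty]
        ext s
        simp only [mem_setOf_eq, mem_empty_iff_false, iff_false, not_and, not_le]
        intro _
        exact h0.trans_le s.2.1
      rw [he, Set.sdiff_empty]
      exact D.isConnected.isPreconnected
    · change IsPreconnected (D.carrier \ rayCurveThrough hu (uniformizer_spec D) '' _)
      rw [carrier_diff_image_rayCurveThrough_eq hu (uniformizer_spec D) h0 hr]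
      exact ((starConvex_diff_raySeg hu _).isPathConnected
        (ray_succ_mem_diff hu _)).isConnected.isPreconnected.image _
        ((uniformizer D).continuousOn.mono Set.sdiff_subset)
  · -- slits are nowhere dense
    intro D r hr
    rcases lt_or_ge r 0 with h0 | h0
    · have he : rayChord u hu D '' {s : I | 0 < (s : ℝ) ∧ (s : ℝ) ≤ r} = ∅ := by
        rw [Set.image_eq_empty]
        ext s
        simp only [mem_setOf_eq, mem_empty_iff_false, iff_false, not_and, not_le]
        intro _
        exact h0.trans_le s.2.1
      rw [he, Set.sdiff_empty]
      exact subset_closure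
    · change D.carrier ⊆ closure (D.carrier \ rayCurveThrough hu (uniformizer_spec D) '' _)
      rw [carrier_diff_image_rayCurveThrough_eq hu (uniformizer_spec D) h0 hr]
      intro y hy
      have hV : (uniformizer D) '' upperHalfPlaneSet = D.carrier := (uniformizer D).bijOn.image_eq
      rw [← hV] at hy
      obtain ⟨w, hw, rfl⟩ := hy
      refine ContinuousWithinAt.mem_closure_image ?_ (subset_closure_diff_raySeg hu _ hw)
      exact ((uniformizer D).continuousOn w hw).mono Set.sdiff_subset
  · -- dependence on `(carrier, a, b)` only
    intro D₁ D₂ hV ha hb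
    set ψ : ConformalEquiv upperHalfPlaneSet D₁.carrier := (uniformizer D₂).copyTarget hV.symm with hψdef
    have hψ : D₁.IsChordalUniformizing ψ := by
      constructor
      · have h := (uniformizer_spec D₂).1
        rw [← ha] at h
        exact h
      · have h := (uniformizer_spec D₂).2
        rw [← hb] at h
        exact h
    obtain ⟨c, hc, h⟩ := MarkedDomain.IsChordalUniformizing.exists_eq_trans_smul_holds (uniformizer_spec D₁) hψ
    refine ⟨rayScale c hc, ?_⟩
    have key := rayCurveThrough_eq_reparam_of_eqOn hu (uniformizer_spec D₁) hψ hc h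
    -- the ray curve through `ψ` is literally the ray chord of `D₂` (same map, same target point)
    have hsame : rayCurveThrough hu hψ = rayChord u hu D₂ := by
      refine Curve.ext (ContinuousMap.ext fun s => ?_)
      change nodeValue ψ.boundaryExtension (D₁.pt 1) (ray u) s =
        nodeValue (uniformizer D₂).boundaryExtension (D₂.pt 1) (ray u) s
      rw [hb]
      rfl
    rw [← hsame, key]
    rfl

end RayFamily


section Covariance

variable {D D' : DobrushinDomain}

/-- Push-forward of a Dirac mass on curve classes along `CurveClass.map Φ` (by hand: the generic
`Measure.map_dirac` does not unify against the Borel structure of `CurveClass`). [folklore] -/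
theorem map_curveClassMap_dirac (Φ : C(ℂ, ℂ)) (x : CurveClass ℂ) :
    (Measure.dirac x).map (CurveClass.map Φ) = Measure.dirac (CurveClass.map Φ x) := by
  ext s hs
  rw [Measure.map_apply (CurveClass.measurable_map Φ) hs, Measure.dirac_apply' _ hs,
    Measure.dirac_apply' _ (CurveClass.measurable_map Φ hs)]
  rfl

/-- **The ray family is conformally covariant.** The image of the ray chord of `(D; a, b)` under a
conformal equivalence `g : D → D'` with `a ↦ a'`, `b ↦ b'` (extended by any continuous `Φ` agreeing
with `g` on `D`) is the ray curve through the uniformizing map `φ_D ≫ g` of `D'`, which differs from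
the chosen one by a dilation of `ℍₒ`, i.e. from the ray chord of `D'` by a Möbius time change.
[folklore] -/
theorem isConformallyCovariant_rayFamily {u : ℂ} (hu : 0 < u.im) :
    (rayFamily u hu).IsConformallyCovariant := by
  intro D D' g Φ h0 h1 hΦ
  change Measure.dirac (CurveClass.mk (rayChord u hu D')) =
    (Measure.dirac (CurveClass.mk (rayChord u hu D))).map (CurveClass.map Φ)
  rw [map_curveClassMap_dirac]
  congr 1
  have hψ : D'.IsChordalUniformizing ((uniformizer D).trans g) := (uniformizer_spec D).trans g h0 h1
  -- the mapped chord is the ray curve through `φ_D ≫ g`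
  have hmap : (rayChord u hu D).map Φ = rayCurveThrough hu hψ := by
    refine Curve.ext (ContinuousMap.ext fun s => ?_)
    change Φ (rayChord u hu D s) = rayCurveThrough hu hψ s
    by_cases hs : (s : ℝ) < 1
    · have hz : ray u (rayParam s) ∈ closure upperHalfPlaneSet := by
        rw [ConformalEquiv.closure_upperHalfPlaneSet_eq]
        exact ray_im_nonneg hu _
      rw [rayCurveThrough_apply_of_lt hu hψ hs,
        show rayChord u hu D s = (uniformizer D).boundaryExtension (ray u (rayParam s)) from
          rayCurveThrough_apply_of_lt hu (uniformizer_spec D) hs,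
        ConformalEquiv.boundaryExtension_trans_eq JordanDomain.exists_hasBoundaryValue_holds
          (uniformizer D) g hΦ hz]
    · obtain rfl : s = 1 := Subtype.ext (le_antisymm s.2.2 (not_lt.1 hs))
      rw [rayCurveThrough_apply_one hu hψ,
        show rayChord u hu D 1 = D.pt 1 from rayCurveThrough_apply_one hu (uniformizer_spec D)]
      exact g.eq_of_hasBoundaryValue_of_eqOn hΦ (frontier_subset_closure (D.pt_mem_frontier 1)) h1
  obtain ⟨c, hc, h⟩ :=
    MarkedDomain.IsChordalUniformizing.exists_eq_trans_smul_holds (uniformizer_spec D') hψ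
  have key := rayCurveThrough_eq_reparam_of_eqOn hu (uniformizer_spec D') hψ hc h
  rw [CurveClass.map_mk, hmap, key]
  exact (CurveClass.mk_reparam _ _).symm

/-- The ray family is covariant under similarities (from conformal covariance). [folklore] -/
theorem isSimilarityCovariant_rayFamily {u : ℂ} (hu : 0 < u.im) :
    (rayFamily u hu).IsSimilarityCovariant :=
  (isConformallyCovariant_rayFamily hu).isSimilarityCovariant

end Covariance

/-! ### Two distinct ray families -/

/-- **The vertical and the tilted ray families differ in every domain**: the point `φ(i)` of the
vertical chord is not on the tilted chord (`φ` injective on `ℍₒ`, and `i ∉ ℝ₊(1 + i)`). [folklore] -/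
theorem rayChord_I_ne (D : DobrushinDomain) :
    CurveClass.mk (rayChord Complex.I (by simp : 0 < (Complex.I).im) D) ≠ CurveClass.mk (rayChord (1 + Complex.I) (by simp : 0 < (1 + Complex.I).im) D) := by
  intro heq
  have hrange : Set.range (rayChord Complex.I (by simp : 0 < (Complex.I).im) D) =
      Set.range (rayChord (1 + Complex.I) (by simp : 0 < (1 + Complex.I).im) D) := by
    have := congrArg CurveClass.range heq
    simpa [CurveClass.range_mk, Curve.range] using this
  set φ := uniformizer D with hφdef
  have hφ := uniformizer_spec D
  -- the point `φ i` of the vertical chord, at parameter `1/2`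
  set s₀ : I := ⟨1 / 2, by norm_num, by norm_num⟩ with hs₀
  have hs₀0 : 0 < (s₀ : ℝ) := by norm_num [hs₀]
  have hs₀1 : (s₀ : ℝ) < 1 := by norm_num [hs₀]
  have hray : rayParam s₀ = 1 := by
    ext
    rw [coe_rayParam]
    norm_num [hs₀]
  obtain ⟨h1, hmem, hcar⟩ := rayCurveThrough_apply_mem (by simp : 0 < (Complex.I).im) hφ hs₀0 hs₀1
  have hp : rayChord Complex.I (by simp : 0 < (Complex.I).im) D s₀ ∈ Set.range (rayChord (1 + Complex.I) (by simp : 0 < (1 + Complex.I).im) D) := by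
    rw [← hrange]
    exact ⟨s₀, rfl⟩
  obtain ⟨s, hs⟩ := hp
  change rayCurveThrough (by simp : 0 < (1 + Complex.I).im) hφ s = rayCurveThrough (by simp : 0 < (Complex.I).im) hφ s₀ at hs
  -- classify the parameter `s`
  rcases eq_or_lt_of_le s.2.1 with h0 | h0
  · have : s = 0 := Subtype.ext h0.symm
    subst this
    rw [rayCurveThrough_apply_zero] at hs
    exact D.pt_notMem_carrier 0 (hs ▸ hcar)
  rcases eq_or_lt_of_le s.2.2 with h1' | h1'
  · have : s = 1 := Subtype.ext h1'
    subst this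
    rw [rayCurveThrough_apply_one] at hs
    exact D.pt_notMem_carrier 1 (hs ▸ hcar)
  · obtain ⟨h2, hmem2, -⟩ := rayCurveThrough_apply_mem (by simp : 0 < (1 + Complex.I).im) hφ h0 h1'
    rw [h1, h2] at hs
    have h3 := φ.injOn hmem2 hmem hs
    rw [hray] at h3
    -- `t (1 + i) = 1 · i` forces `t = 0`
    change ((rayParam s : ℝ) : ℂ) * (1 + Complex.I) = (((1 : ℝ≥0) : ℝ) : ℂ) * Complex.I at h3
    have h4 := congrArg Complex.re h3
    simp only [Complex.mul_re, Complex.ofReal_re, Complex.ofReal_im, Complex.add_re, Complex.one_re,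
      Complex.I_re, Complex.add_im, Complex.one_im, Complex.I_im, NNReal.coe_one, zero_mul, sub_zero,
      mul_zero, add_zero, mul_one] at h4
    have h5 : 0 < ((rayParam s : ℝ≥0) : ℝ) := by
      rw [coe_rayParam]
      exact div_pos h0 (sub_pos.2 h1')
    rw [h4] at h5
    exact lt_irrefl _ h5

/-- The two ray families are different chordal families. [folklore] -/
theorem rayFamily_I_ne : rayFamily Complex.I (by simp : 0 < (Complex.I).im) ≠ rayFamily (1 + Complex.I) (by simp : 0 < (1 + Complex.I).im) := by
  intro heq
  have h := congrFun heq DobrushinDomain.unitDisc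
  change Measure.dirac _ = Measure.dirac _ at h
  set x := CurveClass.mk (rayChord Complex.I (by simp : 0 < (Complex.I).im) DobrushinDomain.unitDisc)
  set y := CurveClass.mk (rayChord (1 + Complex.I) (by simp : 0 < (1 + Complex.I).im) DobrushinDomain.unitDisc)
  have hxy : x ≠ y := rayChord_I_ne DobrushinDomain.unitDisc
  have h1 : Measure.dirac x {x} = Measure.dirac y {x} := by rw [h]
  rw [Measure.dirac_apply_of_mem (mem_singleton x),
    Measure.dirac_apply' _ (measurableSet_singleton x), indicator_of_notMem] at h1
  · exact one_ne_zero h1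
  · exact fun hyx => hxy (mem_singleton_iff.1 hyx).symm

/-! ### The headline: the typed Schramm principle fails -/

/-- **Conformal covariance + the typed domain Markov property + chordality + non-tracing do not
determine a chordal family — not even among deterministic ones.** There are two DISTINCT chordal
families `P₁ ≠ P₂` (the vertical and a tilted ray family), each: chordal, covariant under all
conformal equivalences of Dobrushin domains (hence under all similarities), domain Markov in the
typed sense `ChordalFamily.IsDomainMarkov`, almost surely tracing no boundary arc (clause (ii) of
`SymmetryUpgradeR`), and deterministic (`P D` a Dirac mass for every `D`). Under Werner's domain
Markov property (2007, §3.2 (2): the conditional law of the future is the family's OWN law in the slit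
domain) a deterministic conformally invariant chordal family is the hyperbolic geodesic (Schramm's
principle at `κ = 0`); so the typed `IsMarkovExtension` clause does not carry Schramm's increment
argument (Werner 2007, Lemma 3.3), which is the mechanism named by stub `stub_middleDrivingMartingale`
(S5a) and presupposed by `stub_pinnedSchrammLSW` (S7) of line `SketchIdeatorTwo`. [folklore] -/
theorem typedSchrammPrinciple_fails :
    ∃ P₁ P₂ : ChordalFamily, P₁ ≠ P₂ ∧
      (∀ P ∈ ({P₁, P₂} : Set ChordalFamily),
        P.IsChordal ∧ P.IsConformallyCovariant ∧ P.IsSimilarityCovariant ∧ P.IsDomainMarkov ∧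
        (∀ D : DobrushinDomain, ∀ᵐ γ ∂(P D), ∀ c : Curve ℂ, CurveClass.mk c = γ →
          ∀ s t : unitInterval, s < t → c '' Set.Icc s t ⊆ frontier D.carrier →
            (c '' Set.Icc s t).Subsingleton) ∧
        (∀ D : DobrushinDomain, ∃ γ : CurveClass ℂ, P D = Measure.dirac γ)) := by
  refine ⟨rayFamily Complex.I (by simp : 0 < (Complex.I).im), rayFamily (1 + Complex.I) (by simp : 0 < (1 + Complex.I).im), rayFamily_I_ne, ?_⟩
  have good : ∀ {u : ℂ} (hu : 0 < u.im), (rayFamily u hu).IsChordal ∧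
      (rayFamily u hu).IsConformallyCovariant ∧ (rayFamily u hu).IsSimilarityCovariant ∧
      (rayFamily u hu).IsDomainMarkov ∧
      (∀ D : DobrushinDomain, ∀ᵐ γ ∂(rayFamily u hu D), ∀ c : Curve ℂ, CurveClass.mk c = γ →
        ∀ s t : unitInterval, s < t → c '' Set.Icc s t ⊆ frontier D.carrier →
          (c '' Set.Icc s t).Subsingleton) ∧
      (∀ D : DobrushinDomain, ∃ γ : CurveClass ℂ, rayFamily u hu D = Measure.dirac γ) := by
    intro u hu
    have hc := isSimpleChordFamily_rayChord hu
    exact ⟨hc.isChordal_dirac, isConformallyCovariant_rayFamily hu, isSimilarityCovariant_rayFamily hu,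
      hc.isDomainMarkov_dirac, fun D => hc.nonTracing_dirac D, fun D => ⟨_, rfl⟩⟩
  intro P hP
  rcases hP with rfl | rfl
  · exact good (by simp : 0 < (Complex.I).im)
  · exact good (by simp : 0 < (1 + Complex.I).im)

/-- **Corollary (no typed Schramm rigidity).** It is FALSE that a chordal, conformally covariant,
domain-Markov (typed), non-tracing chordal family is determined by these properties. [folklore] -/
theorem not_typed_schramm_rigidity :
    ¬ (∀ P Q : ChordalFamily,
        P.IsChordal → P.IsConformallyCovariant → P.IsDomainMarkov →
        (∀ D : DobrushinDomain, ∀ᵐ γ ∂(P D), ∀ c : Curve ℂ, CurveClass.mk c = γ →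
          ∀ s t : unitInterval, s < t → c '' Set.Icc s t ⊆ frontier D.carrier →
            (c '' Set.Icc s t).Subsingleton) →
        Q.IsChordal → Q.IsConformallyCovariant → Q.IsDomainMarkov →
        (∀ D : DobrushinDomain, ∀ᵐ γ ∂(Q D), ∀ c : Curve ℂ, CurveClass.mk c = γ →
          ∀ s t : unitInterval, s < t → c '' Set.Icc s t ⊆ frontier D.carrier →
            (c '' Set.Icc s t).Subsingleton) →
        P = Q) := by
  intro h
  obtain ⟨P₁, P₂, hne, hgood⟩ := typedSchrammPrinciple_fails
  obtain ⟨c₁, cc₁, -, m₁, n₁, -⟩ := hgood P₁ (Or.inl rfl)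
  obtain ⟨c₂, cc₂, -, m₂, n₂, -⟩ := hgood P₂ (Or.inr rfl)
  exact hne (h P₁ P₂ c₁ cc₁ m₁ n₁ c₂ cc₂ m₂ n₂)

end Summit.CriticalPhenomena.CardyFormulaZ2.Theorems.SymmetryUpgradeR.Negative

end
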